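import Summits.AtomisticToContinuum.Crystallization.Theses.GappedShellCensus
import Summits.AtomisticToContinuum.Crystallization.Theses.SquareWellLayerCake
import Summits.AtomisticToContinuum.Crystallization.Theses.PalmUnimodularRigidity

/-!
# Strategist sketch (census signatures) — crux `GappedShellCensus.RadialDefectsVanish` (stmt-15930)

Typed statements referred to in `STRATEGY-CENSUS.md` (all `def … : Prop`, no sorry):
* `FarGapVanishes`, `LayerCakeSplit` — Decomposition D2 (layer-cake handover; NOT filed).
* `PalmRadialPinning`, `SelectionFreeSplit` — Decomposition D4 / Transfer fallback (NOT registered).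
* `EveryScaleEventually` — Strengthen S⁺₂ (REFUTED by Disproof §2).
-/

noncomputable section

open MeasureTheory
open scoped ENNReal

namespace Summit.AtomisticToContinuum.Crystallization.Cruxes.RadialDefectsVanish.StrategistCensus

open Literature.MathematicalPhysics.StatisticalMechanics
open Summit.AtomisticToContinuum.Crystallization.Theses

local notation "E3" => EuclideanSpace ℝ (Fin 3)

/-- **D2's new piece — FAR GAP VANISHES (one-sided, energetic):** along every sequence of LJ ground
states the fraction of particles having another particle at distance in the open band `(11/10, 21/17)`
tends to `0`.  With `AveragedTwelve` (K1, stmt-15806) and `TwelveWithinOne` (K2, stmt-15808) it gives the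
crux at the pinned scale `50/51` by the thirteen-line count of `SquareWellLayerCake.closes`.  NOT
geometric at these tolerances (tolerant Hales-L12 fails: a 13th point at norm `1.118` is compatible with
twelve points of norm in `[55/57, 1]`, all thirteen pairwise `≥ 55/57`; `num/l12_tolerant.py`). -/
def FarGapVanishes : Prop :=
  ∀ x : (N : ℕ) → (Fin N → E3), (∀ N, IsGroundState lennardJones (x N)) →
    Filter.Tendsto (fun N : ℕ => (Nat.card {i : Fin N //
      ∃ j : Fin N, 11 / 10 < dist (x N i) (x N j) ∧ dist (x N i) (x N j) < 21 / 17} : ℝ) / N)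
      Filter.atTop (nhds 0)

/-- **D2 — the layer-cake split (typed, glue provable by the count inside `SquareWellLayerCake.closes`;
NOT filed — dominated by the Palm transfer, see the census).** -/
def LayerCakeSplit : Prop :=
  SquareWellLayerCake.AveragedTwelve → SquareWellLayerCake.TwelveWithinOne → FarGapVanishes →
    GappedShellCensus.RadialDefectsVanish

/-- **D4 / fallback — SELECTION-FREE PALM RADIAL PINNING (card layered-scale-lock in Palm clothing):**
there is `σ > 0` such that every minimising point-stationary hard-core law whose root has a.s. a
`(1/100)`-close-packed first shell at its own scale (the conclusion of `MinimiserShells`, 9225,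
verbatim) satisfies a.s. the crux's radial predicate with slack `σ` at the pinned scale `50/51`: all
atoms pairwise `(55/57+σ)`-separated, every atom `w ≠ 0` with `‖w‖ ≤ 1 − σ ∨ ‖w‖ ≥ 21/17 + σ`, exactly
twelve atoms `≠ 0` of norm `≤ 1 − σ`.  Mechanism: Cauchy–Born lower bound in Palm MEAN on the global
Barlow chart (9227, landed) + certified convexity of the Barlow energy in the stiff variables (scale,
layer spacings) uniform in the Hägg word + a sliver lemma `5a_x/4 → 21/17`; no hcp selection. -/
def PalmRadialPinning : Prop :=
  ∃ σ : ℝ, 0 < σ ∧ ∀ δ : ℝ, 0 < δ → ∀ P : Measure (Measure E3), IsProbabilityMeasure P →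
    (∀ᵐ μ ∂P, (∃ S : Set E3, (0 : E3) ∈ S ∧ (∀ x ∈ S, ∀ y ∈ S, x ≠ y → δ ≤ dist x y) ∧
      μ = (Measure.count : Measure E3).restrict S)) →
    (∀ g : Measure E3 → E3 → ℝ≥0∞, Measurable (Function.uncurry g) →
      ∫⁻ μ, ∫⁻ y, g μ y ∂μ ∂P = ∫⁻ μ, ∫⁻ y, g (Measure.map (fun z => z - y) μ) (-y) ∂μ ∂P) →
    (∫ μ, (∫ y, lennardJones ‖y‖ ∂μ) / 2 ∂P) ≤
      (⨅ Q : PeriodicConfiguration 3, Q.energyPerParticle lennardJones) →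
    (∀ᵐ μ ∂P, (∃ a : ℝ, 9 / 10 ≤ a ∧ a ≤ 1 ∧ ∃ T : Finset E3,
      (↑T : Set E3) = {y : E3 | μ {y} ≠ 0 ∧ y ≠ 0 ∧ ‖y‖ ≤ 5 / 4 * a} ∧
      (Literature.Geometry.DiscreteGeometry.ShellCloseTo (a / 100) T
          (Finset.image (fun v : E3 => a • v) Literature.Geometry.DiscreteGeometry.fccKissingPattern) ∨
        Literature.Geometry.DiscreteGeometry.ShellCloseTo (a / 100) T
          (Finset.image (fun v : E3 => a • v) Literature.Geometry.DiscreteGeometry.hcpKissingPattern)))) →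
    ∀ᵐ μ ∂P,
      (∀ w w' : E3, μ {w} ≠ 0 → μ {w'} ≠ 0 → w ≠ w' → 55 / 57 + σ ≤ dist w w') ∧
        (∀ w : E3, μ {w} ≠ 0 → w ≠ 0 → (‖w‖ ≤ 1 - σ ∨ 21 / 17 + σ ≤ ‖w‖)) ∧
        ∃ T : Finset E3, T.card = 12 ∧ (∀ w ∈ T, μ {w} ≠ 0 ∧ w ≠ 0 ∧ ‖w‖ ≤ 1 - σ) ∧
          ∀ w : E3, μ {w} ≠ 0 → w ≠ 0 → ‖w‖ ≤ 1 - σ → w ∈ T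

/-- **D4 — the selection-free split (typed): `MinimiserShells → PalmRadialPinning → crux`** (glue =
`stub_returnRadial` of line `palm_pinned_scale`, proved, + `stub_bsLimitAlong`, landed). NOT registered
now (9226 is staffed and believed; kept as the fallback if 9226 dies substantively). -/
def SelectionFreeSplit : Prop :=
  PalmUnimodularRigidity.MinimiserShells → PalmRadialPinning → GappedShellCensus.RadialDefectsVanish

/-- **S⁺₂ — "every scale of the window, eventually"** (the natural strengthening of the crux): REFUTED
by the disprover (`Disproof.lean` §2 `not_radialDefectsVanishEveryScaleEventually`: the two ends
`47/50` and `1` of the window are mutually exclusive scales). Recorded to keep provers off it. -/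
def EveryScaleEventually : Prop :=
  ∀ x : (N : ℕ) → (Fin N → E3), (∀ N, IsGroundState lennardJones (x N)) →
    ∀ a : ℝ, 47 / 50 ≤ a → a ≤ 1 → ∀ θ : ℝ, 0 < θ → ∀ᶠ N in Filter.atTop,
      (Nat.card {i : Fin N // ¬ ((Finset.univ.filter fun j : Fin N =>
          j ≠ i ∧ dist (x N i) (x N j) ≤ a * (1 + 1 / 50)).card = 12 ∧
        ∀ j : Fin N, j ≠ i → a * (1 - 1 / 50) ≤ dist (x N i) (x N j) ∧
          (dist (x N i) (x N j) ≤ a * (1 + 1 / 50) ∨ a * (63 / 50) ≤ dist (x N i) (x N j)))} : ℝ)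
        ≤ θ * N

/-! Sanity: the pinned scale is admissible and its three numerals are the census's. -/
example : (47 : ℝ) / 50 ≤ 50 / 51 ∧ (50 : ℝ) / 51 ≤ 1 := by norm_num
example : (50 / 51 * (1 + 1 / 50) : ℝ) = 1 ∧ (50 / 51 * (1 - 1 / 50) : ℝ) = 49 / 51 ∧
    (50 / 51 * (63 / 50) : ℝ) = 21 / 17 := by norm_num
/-- The certificate box sits inside the pinned window: `49/51 < 55/57`. -/
example : (49 : ℝ) / 51 < 55 / 57 := by norm_num
/-- The relaxed-hcp bond `a* ≈ 0.97123` sits inside `[49/51, 1]` with margins `> 1 %`. -/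
example : (49 : ℝ) / 51 < 0.9610 ∧ (0.97123 : ℝ) - 0.9610 > 0.0102 := by norm_num

end Summit.AtomisticToContinuum.Crystallization.Cruxes.RadialDefectsVanish.StrategistCensus

end
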